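import Mathlib
import Summits.NavierStokesRegularity.NavierStokesRegularity.Theorems.EulerZoomLiouvillePowerGaugeEulerLiouvilleSelfSimilarBernoulliSqueeze
import Summits.NavierStokesRegularity.NavierStokesRegularity.Theorems.EulerZoomLiouvillePowerGaugeEulerLiouvilleSelfSimilarBernoulliBounded
import Summits.NavierStokesRegularity.NavierStokesRegularity.Theorems.EulerZoomLiouvillePowerGaugeEulerLiouvilleSelfSimilarBernoulliThinness
import Summits.NavierStokesRegularity.NavierStokesRegularity.Theorems.EulerZoomLiouvillePowerGaugeEulerLiouvilleSteadyTools
import Literature.Analysis.FluidPDE.PressureDeterminedUpToTime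
import HarnessLib

/-!
# THE CLASSICAL PRESSURE OF A `C²` PROFILE IS THE MEMBER'S PRESSURE UP TO A CONSTANT, and the SHARP form of
# «super-fast channels squeeze volume too fast» (no far-field pressure hypothesis)
# (crux `EulerZoomLiouville.PowerGaugeEulerLiouville` = stmt-NavierStokesRegularity-19832, line `birth`, THE ONE STATEMENT)

Route №10 `EulerZoomLiouville` (NavierStokesRegularity); width seat ns-ezl-w5 g0.  Fourth file of the (C2) volume-squeeze chain.

* **`WeakToClassical.pressureProfile_ae_eq_add_const`** — the bridge the lineage noted but never typed (`…SelfSimilarWeakToClassical`: «`P =ᵐ P̃ +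
  const` is true but not needed»): for a distributional Euler pair on the slab, exactly self-similar with profile `(V, P)`, `V ∈ C²`, `P ∈ L¹_loc`,
  and ANY classical pressure `P′` of `V` (`IsSelfSimilarEulerProfile γ 0 V P′`, CIV (3.3)), there is a constant `c₀` with `P = P′ + c₀` a.e.
  Proof: both `∫ P div η` (the member's weak profile equation integrated by parts on the smooth side, `integral_pressure_mul_divergence_eq`) and
  `∫ P′ div η` (classical IBP + CIV (3.3)) equal `∫ ⟪DV(γy+V) + (1−γ)V, η⟫` for every test field `η`; with `η = φ e` the difference `P − P′` has
  weak gradient `0` on `ℝ³` (`HasWeakFDerivOn ⊤`), hence is a.e. constant (`ae_eq_const_of_hasWeakFDerivOn_zero`).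
* **`Loc.selfSimilar_ae_eq_zero_of_superFastChannelC2_profile`** — the SHARP member form of the squeeze: crux hypotheses verbatim (`0 < ρ ≤ ½`) + exact
  self-similarity + `V ∈ C²` of linear growth `‖V y‖ ≤ K₁(1+‖y‖)` + for every classical pressure `P′` a far FAST CHANNEL of SUPER-fast rate
  `c₁ > 3/((2+ρ)(1+2ρ))` on every high set `{ℋ_{P′} > h}` ⇒ `u = 0` a.e. — the UNPRESSURISED clause of `Loc.selfSimilar_ae_eq_zero_of_fastChannelC2_profile`
  (…SqueezeMember) is GONE: by the bridge `{ℋ_{P′} > h} = {ℋ_P > h + c₀}` up to a null set, and the high sets of `ℋ_P` are thin with rate `1+2ρ` by the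
  `A`- and `D`-gauges (sz-p1's `BernoulliThinness.volume_bernoulliHigh_inter_far_le`), pressurised or not.

HONEST LABEL: partial model-class stratum for THE ONE STATEMENT (linear growth; SUPER-fast far channels `s − γ ≥ c₁ > 3/((2+ρ)(1+2ρ))`); marginal
channels untouched.  WHAT THIS IS NOT: not NS, not E — a classical sub-stratum + a dictionary lemma `--supports` stmt-19832 on the MODEL lattice (E/NS
strata); 19832 OPEN; NS regularity NOT proved. [folklore; ChaeShvydkoy2013 §2.1 (2.1); ConstantinIgnatovaVicol2026Putative §3.1.1 (3.3), §3.4]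
-/

noncomputable section

-- flat `Theorems/<Route><Decl>…` files of one crux share the namespace of the crux (tree convention)
set_option linter.dupNamespace false

open MeasureTheory Set Filter Topology Metric Function InnerProductSpace TopologicalSpace
open scoped RealInnerProductSpace NNReal ENNReal ContDiff

namespace Summit.NavierStokesRegularity.NavierStokesRegularity.Theorems.PowerGaugeEulerLiouville

open Literature.Analysis Literature.Analysis.FluidPDE Literature.Analysis.FunctionSpaces

/-! ### The bridge: classical pressure = member pressure + constant, a.e. -/

/-- **The classical pressure of a `C²` profile is the member's pressure profile up to an additive constant (a.e.).**  For a distributional Euler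
pair `(u, p)` on `(−∞,0) × ℝ³` exactly self-similar with profile `(V, P)` (`u(τ) = selfSimilarCollapse γ 0 V τ`, `p(τ) = selfSimilarCollapsePressure γ 0 P τ`),
`V ∈ C²`, `P ∈ L¹_loc`, and a classical pressure `P′` with `IsSelfSimilarEulerProfile γ 0 V P′`: `∃ c₀, P =ᵐ P′ + c₀`. [folklore; ChaeShvydkoy2013 §2.1] -/
theorem WeakToClassical.pressureProfile_ae_eq_add_const {γ : ℝ}
    {u : ℝ → EuclideanSpace ℝ (Fin 3) → EuclideanSpace ℝ (Fin 3)} {p : ℝ → EuclideanSpace ℝ (Fin 3) → ℝ}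
    (hsol : IsDistributionalNSSolutionOn (slab (EuclideanSpace ℝ (Fin 3)) (Iio 0) isOpen_Iio) 0 0 u p)
    {V : EuclideanSpace ℝ (Fin 3) → EuclideanSpace ℝ (Fin 3)} {P P' : EuclideanSpace ℝ (Fin 3) → ℝ}
    (hu : ∀ τ : ℝ, τ < 0 → u τ = selfSimilarCollapse γ 0 V τ)
    (hp : ∀ τ : ℝ, τ < 0 → p τ = selfSimilarCollapsePressure γ 0 P τ)
    (hV : ContDiff ℝ 2 V) (hP : LocallyIntegrable P volume) (hprof : IsSelfSimilarEulerProfile γ 0 V P') :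
    ∃ c₀ : ℝ, P =ᵐ[volume] fun y => P' y + c₀ := by
  have hP'1 : ContDiff ℝ 1 P' := hprof.contDiff_pressure
  have hP'c : Continuous P' := hP'1.continuous
  set F : EuclideanSpace ℝ (Fin 3) → EuclideanSpace ℝ (Fin 3) := fun y => fderiv ℝ V y (γ • y + V y) + (1 - γ) • V y with hF
  -- the classical side: `∫ P' div η = ∫ ⟪F, η⟫` for test fields `η`
  have hclass : ∀ η : EuclideanSpace ℝ (Fin 3) → EuclideanSpace ℝ (Fin 3), ContDiff ℝ ∞ η → HasCompactSupport η →
      ∫ y, P' y * VectorCalculus.divergence η y = ∫ y, ⟪F y, η y⟫ := by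
    intro η hη hηc
    have h1 := integral_inner_gradient_eq_neg_integral_mul_divergence hP'1 (hη.of_le (by exact_mod_cast le_top)) hηc
    have h2 : ∀ y, gradient P' y = -F y := by
      intro y
      have h := hprof.profile_eq y
      simp only [sub_zero] at h
      have h' : gradient P' y = -((1 - γ) • V y + fderiv ℝ V y (γ • y + V y)) := eq_neg_of_add_eq_zero_right h
      rw [h']
      show -((1 - γ) • V y + fderiv ℝ V y (γ • y + V y)) = -(fderiv ℝ V y (γ • y + V y) + (1 - γ) • V y)
      rw [add_comm]
    have h3 : ∫ y, ⟪gradient P' y, η y⟫ = -∫ y, ⟪F y, η y⟫ := by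
      rw [← integral_neg]
      exact integral_congr_ae (ae_of_all _ fun y => by simp only [h2 y, inner_neg_left])
    linarith
  -- the member side: `∫ P div η = ∫ ⟪F, η⟫`
  have hmember : ∀ η : EuclideanSpace ℝ (Fin 3) → EuclideanSpace ℝ (Fin 3),
      IsTestFunctionOn (⊤ : Opens (EuclideanSpace ℝ (Fin 3))) η →
      ∫ y, P y * VectorCalculus.divergence η y = ∫ y, ⟪F y, η y⟫ := fun η hη =>
    WeakToClassical.integral_pressure_mul_divergence_eq hsol hu hp hV hP hη
  -- hence `P - P'` has weak gradient zero on `ℝ³`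
  set f : EuclideanSpace ℝ (Fin 3) → ℝ := fun y => P y - P' y with hf
  have hfw : HasWeakFDerivOn (⊤ : Opens (EuclideanSpace ℝ (Fin 3))) volume f 0 := by
    refine ⟨?_, ?_, ?_⟩
    · exact (hP.sub hP'c.locallyIntegrable).locallyIntegrableOn _
    · exact (locallyIntegrable_const (0 : EuclideanSpace ℝ (Fin 3) →L[ℝ] ℝ)).locallyIntegrableOn _
    · intro φ v hφ
      have hηc : HasCompactSupport (fun y => φ y • v) :=
        hφ.hasCompactSupport.mono fun y hy => by
          rw [Function.mem_support] at hy ⊢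
          intro h0; exact hy (by rw [h0, zero_smul])
      have hη : IsTestFunctionOn (⊤ : Opens (EuclideanSpace ℝ (Fin 3))) (fun y => φ y • v) :=
        ⟨hφ.contDiff.smul contDiff_const, hηc, by rw [TopologicalSpace.Opens.coe_top]; exact subset_univ _⟩
      have hdiv : ∀ y, VectorCalculus.divergence (fun y => φ y • v) y = fderiv ℝ φ y v := fun y =>
        divergence_smul_const_eq_fderiv_apply ((hφ.contDiff.differentiable (by simp)) y) v
      -- integrability of the two products
      have hφ1 : Continuous fun y => fderiv ℝ φ y v :=
        (hφ.contDiff.continuous_fderiv (by simp)).clm_apply continuous_const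
      have hφvc : HasCompactSupport fun y => fderiv ℝ φ y v :=
        (hφ.hasCompactSupport.fderiv (𝕜 := ℝ)).mono fun y hy => by
          rw [Function.mem_support] at hy ⊢
          intro h0; exact hy (by simp [h0])
      have hI1 : Integrable fun y => fderiv ℝ φ y v * P y := by
        simpa [smul_eq_mul] using (hP.integrable_smul_left_of_hasCompactSupport hφ1 hφvc)
      have hI2 : Integrable fun y => fderiv ℝ φ y v * P' y := by
        simpa [smul_eq_mul] using (hP'c.locallyIntegrable.integrable_smul_left_of_hasCompactSupport hφ1 hφvc)
      have e1 : ∫ y, fderiv ℝ φ y v * P y = ∫ y, ⟪F y, φ y • v⟫ := by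
        rw [← hmember _ hη]
        exact integral_congr_ae (ae_of_all _ fun y => by simp only [hdiv y]; ring)
      have e2 : ∫ y, fderiv ℝ φ y v * P' y = ∫ y, ⟪F y, φ y • v⟫ := by
        rw [← hclass _ hη.contDiff hη.hasCompactSupport]
        exact integral_congr_ae (ae_of_all _ fun y => by simp only [hdiv y]; ring)
      have hR : (fun x : EuclideanSpace ℝ (Fin 3) =>
          φ x • (0 : EuclideanSpace ℝ (Fin 3) → EuclideanSpace ℝ (Fin 3) →L[ℝ] ℝ) x v) = fun _ => 0 := by
        funext x; simp
      rw [hR]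
      simp only [TopologicalSpace.Opens.coe_top, Measure.restrict_univ, integral_zero, neg_zero, smul_eq_mul, hf, mul_sub]
      rw [integral_sub hI1 hI2, e1, e2, sub_self]
  obtain ⟨c, hc⟩ := ae_eq_const_of_hasWeakFDerivOn_zero hfw
  refine ⟨c, ?_⟩
  filter_upwards [hc] with y hy
  simp only [hf] at hy
  linarith

/-! ### The sharp member theorem -/

/-- **EXACTLY SELF-SIMILAR MEMBERS WHOSE `C²` PROFILE OF LINEAR GROWTH HAS A SUPER-FAST FAR CHANNEL ARE TRIVIAL — no far-field pressure hypothesis**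
(crux hypotheses verbatim, `0 < ρ ≤ ½`, `γ = 1/(2+ρ)`; `V ∈ C²`, `‖V y‖ ≤ K₁(1+‖y‖)`; for every classical pressure `P′` of `V`, on the far part of every
high set `{ℋ_{P′} > h}` the channel bound `⟪y, γy + V y⟫ ≤ −c₁‖y‖²`, `c₁ > 3/((2+ρ)(1+2ρ))`).  The high sets are thin with rate `1+2ρ` by the `A`- and
`D`-gauges through the bridge `P = P′ + c₀` a.e.; then the squeeze `Loc.curl_eq_zero_of_fastChannel_of_thin` and the irrotational `C²` stratum. [folklore] -/
theorem Loc.selfSimilar_ae_eq_zero_of_superFastChannelC2_profile {ρ : ℝ} (hρ : 0 < ρ) (hρ1 : ρ ≤ 1 / 2)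
    {u : ℝ → EuclideanSpace ℝ (Fin 3) → EuclideanSpace ℝ (Fin 3)} {p : ℝ → EuclideanSpace ℝ (Fin 3) → ℝ}
    {H : ℝ → EuclideanSpace ℝ (Fin 3) → EuclideanSpace ℝ (Fin 3) →L[ℝ] EuclideanSpace ℝ (Fin 3)} {c : ℝ≥0}
    (hsw : IsSuitableWeakSolutionOn (slab (EuclideanSpace ℝ (Fin 3)) (Iio 0) isOpen_Iio) 0 0 u p)
    (hgauge : ∀ a : ℝ, 0 < a →
      ENNReal.ofReal (a ^ (2 * ρ)) * cknA a (0 : ℝ × EuclideanSpace ℝ (Fin 3)) u +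
          ENNReal.ofReal (a ^ ρ) * cknE a (0 : ℝ × EuclideanSpace ℝ (Fin 3)) H +
        ENNReal.ofReal (a ^ (2 * ρ)) * cknD a (0 : ℝ × EuclideanSpace ℝ (Fin 3)) p ≤ (c : ℝ≥0∞))
    {V : EuclideanSpace ℝ (Fin 3) → EuclideanSpace ℝ (Fin 3)} {P : EuclideanSpace ℝ (Fin 3) → ℝ}
    (hu : ∀ τ : ℝ, τ < 0 → u τ = selfSimilarCollapse (1 / (2 + ρ)) 0 V τ)
    (hp : ∀ τ : ℝ, τ < 0 → p τ = selfSimilarCollapsePressure (1 / (2 + ρ)) 0 P τ)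
    (hV : ContDiff ℝ 2 V) {K₁ : ℝ} (hK₁ : ∀ y : EuclideanSpace ℝ (Fin 3), ‖V y‖ ≤ K₁ * (1 + ‖y‖))
    {c₁ : ℝ} (hc₁ : 3 / ((2 + ρ) * (1 + 2 * ρ)) < c₁)
    (hB : ∀ P' : EuclideanSpace ℝ (Fin 3) → ℝ, IsSelfSimilarEulerProfile (1 / (2 + ρ)) 0 V P' →
      ∀ h : ℝ, ∃ R₀ : ℝ, ∀ y : EuclideanSpace ℝ (Fin 3), R₀ ≤ ‖y‖ →
        h < selfSimilarBernoulli (1 / (2 + ρ)) 0 V P' y →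
          ⟪y, selfSimilarTransport (1 / (2 + ρ)) 0 V y⟫ ≤ -(c₁ * ‖y‖ ^ 2)) :
    uncurry u =ᵐ[volume.restrict (Iio (0 : ℝ) ×ˢ (univ : Set (EuclideanSpace ℝ (Fin 3))))] 0 := by
  -- adapted from `Loc.selfSimilar_ae_eq_zero_of_fastChannelC2_profile` (…SelfSimilarBernoulliSqueezeMember)
  have hρ1' : ρ < 1 := by linarith
  have h2ρ : (0 : ℝ) < 2 + ρ := by linarith
  have hγ : (0 : ℝ) < 1 / (2 + ρ) := one_div_pos.2 h2ρ
  have hγ2 : 1 / (2 + ρ) < 1 / 2 := one_div_lt_one_div_of_lt two_pos (by linarith)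
  have hA : ∀ a : ℝ, 0 < a → ENNReal.ofReal (a ^ (2 * ρ)) *
      cknA a (0 : ℝ × EuclideanSpace ℝ (Fin 3)) u ≤ (c : ℝ≥0∞) :=
    fun a ha => le_trans (le_trans le_self_add le_self_add) (hgauge a ha)
  have hD : ∀ a : ℝ, 0 < a → ENNReal.ofReal (a ^ (2 * ρ)) *
      cknD a (0 : ℝ × EuclideanSpace ℝ (Fin 3)) p ≤ (c : ℝ≥0∞) :=
    fun a ha => le_trans le_add_self (hgauge a ha)
  have hum : AEStronglyMeasurable (uncurry u)
      (volume.restrict (Iio (0 : ℝ) ×ˢ (univ : Set (EuclideanSpace ℝ (Fin 3))))) := by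
    have := hsw.distributional.1.aestronglyMeasurable
    simpa [slab] using this
  have hpm : AEStronglyMeasurable (uncurry p)
      (volume.restrict (Iio (0 : ℝ) ×ˢ (univ : Set (EuclideanSpace ℝ (Fin 3))))) := by
    have := hsw.distributional.2.2.1.aestronglyMeasurable
    simpa [slab] using this
  have hVm : AEStronglyMeasurable V volume := aestronglyMeasurable_profile hum hu
  have hPm := aestronglyMeasurable_pressureProfile hpm hp
  have hDprof := profile_pressure_weight_of_gaugeD hρ hρ1' hpm hp hD
  have hP1 : LocallyIntegrable P volume :=
    EnergySaturation.locallyIntegrable_pressure_of_weight hρ1' hPm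
      (ENNReal.mul_ne_top ENNReal.ofReal_ne_top ENNReal.coe_ne_top) hDprof
  have hAprof := profile_energy_growth_of_gaugeA hρ hu hA
  obtain ⟨P', hprof⟩ := WeakToClassical.exists_isSelfSimilarEulerProfile_of_contDiff hsw.distributional hu hp hV hP1
  have hfast := hB P' hprof
  -- the bridge: `P = P' + c₀` a.e.
  obtain ⟨c₀, hc₀⟩ := WeakToClassical.pressureProfile_ae_eq_add_const hsw.distributional hu hp hV hP1 hprof
  -- thinness of the high sets of `ℋ_P` from the `A`- and `D`-gauges (sz-p1)
  have hD' : ∫⁻ y, ‖P y‖ₑ ^ (3 / 2 : ℝ) * ENNReal.ofReal (‖y‖ ^ (2 * ρ - 2)) ≤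
      ENNReal.ofReal ((2 - 2 * ρ) / (2 + ρ) * (c : ℝ)) := by
    refine hDprof.trans (le_of_eq ?_)
    rw [ENNReal.ofReal_mul (by apply div_nonneg <;> linarith), ENNReal.ofReal_coe_nnreal]
  -- transfer to the high sets of `ℋ_{P'}` (a.e. equal up to the level shift `c₀`)
  have hthin : ∀ h : ℝ, ∃ C R₂ : ℝ, 0 < R₂ ∧ ∀ R : ℝ, R₂ ≤ R →
      volume ({y : EuclideanSpace ℝ (Fin 3) | h < selfSimilarBernoulli (1 / (2 + ρ)) 0 V P' y} ∩ {y | R ≤ ‖y‖}) ≤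
        ENNReal.ofReal (C * R ^ (-(1 + 2 * ρ))) := by
    intro h
    obtain ⟨C'', L₀, hL₀, hfar⟩ :=
      BernoulliThinness.volume_bernoulliHigh_inter_far_le hρ hρ1' hVm hAprof hPm hD' (h + c₀)
    refine ⟨C'', L₀, hL₀, fun R hR => ?_⟩
    have hae : ∀ᵐ y ∂(volume : Measure (EuclideanSpace ℝ (Fin 3))),
        y ∈ ({y : EuclideanSpace ℝ (Fin 3) | h < selfSimilarBernoulli (1 / (2 + ρ)) 0 V P' y} ∩ {y | R ≤ ‖y‖}) →
          y ∈ ({y : EuclideanSpace ℝ (Fin 3) | h + c₀ < selfSimilarBernoulli (1 / (2 + ρ)) 0 V P y} ∩ {y | R ≤ ‖y‖}) := by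
      filter_upwards [hc₀] with y hy
      rintro ⟨h1, h2⟩
      refine ⟨?_, h2⟩
      simp only [mem_setOf_eq, selfSimilarBernoulli_apply] at h1 ⊢
      rw [hy]
      linarith
    refine (measure_mono_ae hae).trans ?_
    rw [show -(1 + 2 * ρ) = -1 - 2 * ρ by ring]
    exact hfar R hR
  have hrace : 3 * (1 / (2 + ρ)) < c₁ * (1 + 2 * ρ) := by
    have h12 : (0 : ℝ) < 1 + 2 * ρ := by linarith
    have h1 := (div_lt_iff₀ (by positivity : (0 : ℝ) < (2 + ρ) * (1 + 2 * ρ))).1 hc₁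
    rw [show 3 * (1 / (2 + ρ)) = 3 / (2 + ρ) by ring, div_lt_iff₀ h2ρ]
    nlinarith
  have hc₁0 : 0 < c₁ := lt_trans (by positivity) hc₁
  have hcurl : ∀ x, curl V x = 0 := fun x =>
    Loc.curl_eq_zero_of_fastChannel_of_thin hprof hγ hγ2 hK₁ hc₁0 hrace hthin hfast x
  exact Loc.selfSimilar_ae_eq_zero_of_irrotationalC2_profile hρ hsw.distributional hA hu hV hcurl

end Summit.NavierStokesRegularity.NavierStokesRegularity.Theorems.PowerGaugeEulerLiouville

end
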